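import Summits.QuantumFields.BalabanUV.Beta.FP.PeriodisedBorderTables
import Summits.QuantumFields.BalabanUV.Beta.FP.CompositeStencilTables

/-!
# `BalabanUV.Beta.FP.PeriodisedBorderTablesRecord` — road «FP» for binder row D1, ROUTE T row **(T-ID)**, border-table ∕ insertion half AT THE RECORD: the torus
# insertions of the tables OF RECORD — the composite border tables `VComp … m`, `V₂Comp … m` of R-FP-50 (a) over `(qSym Lc, lamPerfect, tabs.V, tabs.vh₂S)`
# and the coarse-indexed one-step tables `tabs.H`, `tabs.M j` — UNCONDITIONALLY (their covariance letters are tree theorems ∕ record fields), plus the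
# DEAD SLOTS and the LIVE border entry of the composite tables (`m ≠ 1`, where `VComp … m` IS a packing, `VComp_of_ne_one`)

HONEST DEPENDENCY (page 1, mandatory): continuum YM on T⁴ ⇐ BetaPertH ∧ nine spine estimates (0/9 proved); BetaPertH ⇐ (D1) ∧ (D4) ∧ CAP+tail;
G-an2-4 gates asym, D1 and NE2/3/4.  HONEST FRAMING (cell contract, verbatim): «discharging `BetaPertH` makes Bałaban's UV stability UNCONDITIONAL —
a real constructive-QFT result; it is NOT the continuum limit and NOT the Clay problem.»  ABSOLUTE RULE (cell charter, verbatim): «No internally-minted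
statement may enter as a cited fact. Every hypothesis is either kernel-proved in this package or a verbatim quotation of a PUBLISHED theorem with page
reference. The manuscript(s) under audit are NOT citable for their own disputed steps — they are the thing under adjudication; programme-internal
(2001/route/tribunal) claims are never citable.»  THIS MODULE is [our object] composition BY NAME of `FP/PeriodisedBorderTables` (generic) with the record's
letters (`CompositeStencilTables.VComp_record_translate` ∕ `V₂Comp_record_translate`, `SymTables.hHt ∕ hMt`, `qSym_translate`, `HComp_translate`,
`rowsK_translate`); no `def`, no `def … : Prop`, nothing cited, 0 sorry; 0 estimates; 0∕4 row-D1 binders; NOT (T-ID) itself, NOT SDF, NOT D1, NOT BetaPertH,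
NOT continuum, NOT Clay.  «not in print; our bookkeeping».

CONTENT (generic `d`; one-step blocking `Lc`; `tabs : SymTables d Lc`; period `M` with `M_i = Lc^m · M′_i` resp. `Lc · M′_i`).
* §1 generic, coarse-indexed families (`T ρ (w + t) = shiftK (−N•t) (T ρ w)` — the (TH)∕(TM) letter shape; `H`, `M j`, `HComp … m` have it):
  **`dper_apply_of_siteCov`** `dper M (T ρ w) x y a b = Σ'_m T ρ (w + M′∘m) x y a b` (`M = N·M′`; re-indexing only).
* §2 record, first order: **`dper_VComp_record`** (`dper M (VComp … m κ u) = Σ'_n VComp … m κ (u + M∘n)`, `M = Lc^m·M′`), `dper_VComp_record_translate_bond`,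
  `dper_H_record` (`M = Lc·M′`, coarse bond index), `dper_M_record` (every level `j`).
* §3 record, second order: **`dper_V₂Comp_record`** (simultaneous copies of the bond pair) and the relative period sum `tsum_dper_V₂Comp_record_snd`
  (the second-jet insertion of a torus bond pair — `PeriodisedBorderTables` §7's located remark).
* §4 the composite border tables ARE packings for `m ≠ 1`: dead slots `perZ_dper_VComp_inl_inl ∕ _inr_inr ∕ _inl_inr_of_off_ne_zero ∕ _inr_inl_of_off_ne_zero`
  and the LIVE entry **`perZ_dper_VComp_inl_inr'`** `= [off (Lc^m) z = 0] · Σ'_{n′} Σ'_n HComp Lc (qSym Lc) lamPerfect (rowsK Lc tabs.V) m ρ (blk (Lc^m) z) (u + M∘n)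
  (x + M∘n′) (inl κ) (inl α)` — D1's composite Hessian-shaped tensor on the UNPACKED border rows, at the multiplier block, doubly periodised (no hypothesis).
NOT HERE: `m = 1` dead slots (the record `tabs.V` carries no block-shape field; an1's VALUES are `packVH`-shaped and meet `PeriodisedBorderTables` §3 directly),
the compression to `kkt` form, any identification with Bałaban's objects.  Provenance: D1 formalisation swarm LEAF PROVER 02, unit b2b-balaban-beta-d1-formalise-leaf-02
gen 16, 2026-08-21.  No existing file touched. -/

noncomputable section

open scoped BigOperators

namespace Summit.QuantumFields.BalabanUV.Beta.FP.PeriodisedBorderTablesRecord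

open Literature.MathematicalPhysics.QuantumFieldTheory.Balaban1983to89
open Literature.MathematicalPhysics.QuantumFieldTheory.Balaban1983to89.Beta
open B4TorusKernel.MultiPeriod (translate)
open B4Reflection242 (translate_translate)
open ExpKernelCalculus (MKer shiftK)
open AffineAveraging (Site)
open AveragingContours (blk off)
open OneStepResolventKernel (Fib)
open Summit.QuantumFields.BalabanUV.Beta.SymmetrisedStepJets (SymTables)
open Summit.QuantumFields.BalabanUV.Beta.FP.KernelPeriodisationFib (perZ translate_eq_add)
open Summit.QuantumFields.BalabanUV.Beta.FP.KernelPeriodisationFibLoc (dper dper_apply)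
open Summit.QuantumFields.BalabanUV.Beta.FP.PerfectSecondOrderTablesInf (qSym lamPerfect)
open Summit.QuantumFields.BalabanUV.Beta.FP.PerfectSecondOrderTablesTranslate (qSym_translate)
open Summit.QuantumFields.BalabanUV.Beta.FP.CompositeAveragingTablesInf (HComp)
open Summit.QuantumFields.BalabanUV.Beta.FP.CompositeAveragingTablesTranslate (HComp_translate)
open Summit.QuantumFields.BalabanUV.Beta.FP.CompositeBorderTables (rowsK packK VComp V₂Comp VComp_of_ne_one)
open Summit.QuantumFields.BalabanUV.Beta.FP.CompositeBorderTablesLetters (rowsK_translate)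
open Summit.QuantumFields.BalabanUV.Beta.FP.CompositeStencilTables (VComp_record_translate V₂Comp_record_translate)
open Summit.QuantumFields.BalabanUV.Beta.FP.PeriodisedBorderTables (periodVec_eq_smul translate_eq_add_smul translate_neg_add dper_apply_of_blockCov
  dper_translate_bond dper_apply_of_blockCov₂ tsum_dper_translate_snd perZ_dper_packK_inl_inl perZ_dper_packK_inr_inr perZ_dper_packK_inl_inr_of_off_ne_zero
  perZ_dper_packK_inr_inl_of_off_ne_zero perZ_dper_packK_inl_inr')

variable {d : ℕ} {F : Type*}

/-! ## §1 Coarse-indexed families: the sum over the coarse-period copies of the bond -/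

section SiteCov

variable {N : ℕ} {M M' : Fin (d + 1) → ℕ} {T : Fin (d + 1) → Site (d + 1) → MKer (d + 1) F}

/-- [folklore] one translated copy for a family indexed by a COARSE site: `T ρ w (x + M∘m) (y + M∘m) = T ρ (w − M′∘m) x y`. -/
theorem apply_translate_of_siteCov (hM : ∀ i, M i = N * M' i)
    (hT : ∀ (ρ : Fin (d + 1)) (w t : Site (d + 1)), T ρ (w + t) = shiftK (-((N : ℤ) • t)) (T ρ w))
    (ρ : Fin (d + 1)) (w m x y : Site (d + 1)) (a b : F) :
    T ρ w (translate M x m) (translate M y m) a b = T ρ (translate M' w (-m)) x y a b := by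
  have hw : translate M' w (-m) + (fun i => (M' i : ℤ) * m i) = w := translate_neg_add w m
  have h := hT ρ (translate M' w (-m)) (fun i => (M' i : ℤ) * m i)
  rw [hw] at h
  rw [h]
  simp only [shiftK]
  rw [translate_eq_add_smul hM x m, translate_eq_add_smul hM y m, add_neg_cancel_right, add_neg_cancel_right]

/-- [folklore] **`dper_apply_of_siteCov`**: for a family indexed by a coarse site with the (TH)∕(TM) letter at blocking `N` and a period `M = N·M′`,
`dper M (T ρ w) x y a b = Σ'_m T ρ (w + M′∘m) x y a b` — the sum over the COARSE-period copies of the bond (re-indexing only). -/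
theorem dper_apply_of_siteCov (hM : ∀ i, M i = N * M' i)
    (hT : ∀ (ρ : Fin (d + 1)) (w t : Site (d + 1)), T ρ (w + t) = shiftK (-((N : ℤ) • t)) (T ρ w))
    (ρ : Fin (d + 1)) (w x y : Site (d + 1)) (a b : F) :
    dper M (T ρ w) x y a b = ∑' m : Site (d + 1), T ρ (translate M' w m) x y a b := by
  rw [dper_apply, ← (Equiv.neg (Site (d + 1))).tsum_eq fun m => T ρ (translate M' w m) x y a b]
  exact tsum_congr fun m => apply_translate_of_siteCov hM hT ρ w m x y a b

end SiteCov

/-! ## §2 The record, first order -/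

section RecordFirst

variable {Lc : ℕ} [NeZero Lc] (tabs : SymTables d Lc) {M M' : Fin (d + 1) → ℕ}

/-- [our object — bookkeeping] **THE TORUS INSERTION OF THE COMPOSITE BORDER TABLE OF RECORD** (every `m`; period `M = Lc^m · M′`):
`dper M (VComp … m κ u) x y a b = Σ'_n VComp … m κ (u + M∘n) x y a b`, UNCONDITIONALLY (`VComp_record_translate`). -/
theorem dper_VComp_record (m : ℕ) (hM : ∀ i, M i = Lc ^ m * M' i) (κ : Fin (d + 1)) (u x y : Site (d + 1)) (a b : Fib d) :
    dper M (VComp Lc (qSym Lc) lamPerfect tabs.V m κ u) x y a b =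
      ∑' n : Site (d + 1), VComp Lc (qSym Lc) lamPerfect tabs.V m κ (translate M u n) x y a b :=
  dper_apply_of_blockCov hM (VComp_record_translate tabs m) κ u x y a b

/-- [our object — bookkeeping] … and it depends on the bond only through the torus bond. -/
theorem dper_VComp_record_translate_bond (m : ℕ) (hM : ∀ i, M i = Lc ^ m * M' i) (κ : Fin (d + 1)) (u n₀ : Site (d + 1)) :
    dper M (VComp Lc (qSym Lc) lamPerfect tabs.V m κ (translate M u n₀)) = dper M (VComp Lc (qSym Lc) lamPerfect tabs.V m κ u) :=
  dper_translate_bond hM (VComp_record_translate tabs m) κ u n₀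

omit [NeZero Lc] in
/-- [our object — bookkeeping] **THE TORUS INSERTION OF THE FIELD–FIELD HESSIAN TABLE OF RECORD** (coarse bond index; period `M = Lc · M′`):
`dper M (tabs.H μ y) x z a b = Σ'_n tabs.H μ (y + M′∘n) x z a b` ((TH) = `tabs.hHt`). -/
theorem dper_H_record (hM : ∀ i, M i = Lc * M' i) (μ : Fin (d + 1)) (y x z : Site (d + 1)) (a b : Fib d) :
    dper M (tabs.H μ y) x z a b = ∑' n : Site (d + 1), tabs.H μ (translate M' y n) x z a b :=
  dper_apply_of_siteCov hM tabs.hHt μ y x z a b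

omit [NeZero Lc] in
/-- [our object — bookkeeping] **THE TORUS INSERTION OF THE LEVEL-`j` MULTIPLIER TABLE OF RECORD** ((TM) = `tabs.hMt j`). -/
theorem dper_M_record (hM : ∀ i, M i = Lc * M' i) (j : ℕ) (μ : Fin (d + 1)) (w x z : Site (d + 1)) (a b : Fib d) :
    dper M (tabs.M j μ w) x z a b = ∑' n : Site (d + 1), tabs.M j μ (translate M' w n) x z a b :=
  dper_apply_of_siteCov hM (tabs.hMt j) μ w x z a b

end RecordFirst

/-! ## §3 The record, second order -/

section RecordSecond

variable {Lc : ℕ} [NeZero Lc] (tabs : SymTables d Lc) {M M' : Fin (d + 1) → ℕ}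

/-- [our object — bookkeeping] **THE TORUS INSERTION OF THE COMPOSITE SECOND-ORDER BORDER TABLE OF RECORD, SIMULTANEOUS COPIES** (every `m`, every sign `ε`;
`M = Lc^m · M′`): `dper M (V₂Comp ε … m κ u κ′ u′) x y a b = Σ'_n V₂Comp ε … m κ (u + M∘n) κ′ (u′ + M∘n) x y a b` (`V₂Comp_record_translate`). -/
theorem dper_V₂Comp_record (ε : ℝ) (m : ℕ) (hM : ∀ i, M i = Lc ^ m * M' i) (κ : Fin (d + 1)) (u : Site (d + 1)) (κ' : Fin (d + 1))
    (u' x y : Site (d + 1)) (a b : Fib d) :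
    dper M (V₂Comp ε Lc (qSym Lc) lamPerfect tabs.V tabs.vh₂S m κ u κ' u') x y a b =
      ∑' n : Site (d + 1), V₂Comp ε Lc (qSym Lc) lamPerfect tabs.V tabs.vh₂S m κ (translate M u n) κ' (translate M u' n) x y a b :=
  dper_apply_of_blockCov₂ hM (V₂Comp_record_translate tabs ε m) κ u κ' u' x y a b

/-- [our object — bookkeeping] **THE SECOND-JET INSERTION OF A TORUS BOND PAIR** (the relative period sum of `PeriodisedBorderTables` §7, at the record):
`Σ'_{n′} dper M (V₂Comp ε … m κ u κ′ (u′ + M∘n′)) x y a b = Σ'_{n′} Σ'_n V₂Comp ε … m κ (u + M∘n) κ′ (u′ + M∘(n′ + n)) x y a b`. -/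
theorem tsum_dper_V₂Comp_record_snd (ε : ℝ) (m : ℕ) (hM : ∀ i, M i = Lc ^ m * M' i) (κ : Fin (d + 1)) (u : Site (d + 1)) (κ' : Fin (d + 1))
    (u' x y : Site (d + 1)) (a b : Fib d) :
    ∑' n' : Site (d + 1), dper M (V₂Comp ε Lc (qSym Lc) lamPerfect tabs.V tabs.vh₂S m κ u κ' (translate M u' n')) x y a b =
      ∑' n' : Site (d + 1), ∑' n : Site (d + 1),
        V₂Comp ε Lc (qSym Lc) lamPerfect tabs.V tabs.vh₂S m κ (translate M u n) κ' (translate M u' (n' + n)) x y a b :=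
  tsum_dper_translate_snd hM (V₂Comp_record_translate tabs ε m) κ u κ' u' x y a b

end RecordSecond

/-! ## §4 The composite border tables are packings (`m ≠ 1`): dead slots and the live entry -/

section Packed

variable {Lc : ℕ} [NeZero Lc] (tabs : SymTables d Lc) {M M' : Fin (d + 1) → ℕ} {m : ℕ}

omit [NeZero Lc] in
/-- [our object — bookkeeping] the torus composite border matrix has no ff block (`m ≠ 1`) … -/
theorem perZ_dper_VComp_inl_inl (hm : m ≠ 1) (κ : Fin (d + 1)) (u x y : Site (d + 1)) (α α' : Fin (d + 1)) :
    perZ M (dper M (VComp Lc (qSym Lc) lamPerfect tabs.V m κ u)) x y (Sum.inl α) (Sum.inl α') = 0 := by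
  rw [VComp_of_ne_one Lc (qSym Lc) lamPerfect tabs.V hm]; exact perZ_dper_packK_inl_inl _ κ u x y α α'

omit [NeZero Lc] in
/-- [our object — bookkeeping] … no mm block … -/
theorem perZ_dper_VComp_inr_inr (hm : m ≠ 1) (κ : Fin (d + 1)) (u x y : Site (d + 1)) (ρ ρ' : Fin (d + 1)) :
    perZ M (dper M (VComp Lc (qSym Lc) lamPerfect tabs.V m κ u)) x y (Sum.inr ρ) (Sum.inr ρ') = 0 := by
  rw [VComp_of_ne_one Lc (qSym Lc) lamPerfect tabs.V hm]; exact perZ_dper_packK_inr_inr _ κ u x y ρ ρ'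

omit [NeZero Lc] in
/-- [our object — bookkeeping] … DEAD multiplier columns off the `Lc^m`-sublattice … -/
theorem perZ_dper_VComp_inl_inr_of_off_ne_zero (hm : m ≠ 1) (hM : ∀ i, M i = Lc ^ m * M' i) (κ : Fin (d + 1)) (u x : Site (d + 1))
    {z : Site (d + 1)} (hz : off (Lc ^ m) z ≠ 0) (α ρ : Fin (d + 1)) :
    perZ M (dper M (VComp Lc (qSym Lc) lamPerfect tabs.V m κ u)) x z (Sum.inl α) (Sum.inr ρ) = 0 := by
  rw [VComp_of_ne_one Lc (qSym Lc) lamPerfect tabs.V hm]; exact perZ_dper_packK_inl_inr_of_off_ne_zero _ κ u hM hz x α ρ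

omit [NeZero Lc] in
/-- [our object — bookkeeping] … and DEAD multiplier rows off the `Lc^m`-sublattice. -/
theorem perZ_dper_VComp_inr_inl_of_off_ne_zero (hm : m ≠ 1) (hM : ∀ i, M i = Lc ^ m * M' i) (κ : Fin (d + 1)) (u z : Site (d + 1))
    {x : Site (d + 1)} (hx : off (Lc ^ m) x ≠ 0) (ρ α : Fin (d + 1)) :
    perZ M (dper M (VComp Lc (qSym Lc) lamPerfect tabs.V m κ u)) x z (Sum.inr ρ) (Sum.inl α) = 0 := by
  rw [VComp_of_ne_one Lc (qSym Lc) lamPerfect tabs.V hm]; exact perZ_dper_packK_inr_inl_of_off_ne_zero _ κ u hM hx z ρ α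

/-- [our object — bookkeeping] **THE LIVE ENTRY OF THE TORUS COMPOSITE BORDER MATRIX OF RECORD** (`m ≠ 1`, `M = Lc^m · M′`; NO hypothesis beyond those):
`perZ M (dper M (VComp … m κ u)) x z (inl α) (inr ρ) = [off (Lc^m) z = 0] · Σ'_{n′} Σ'_n HComp Lc (qSym Lc) lamPerfect (rowsK Lc tabs.V) m ρ (blk (Lc^m) z) (u + M∘n) (x + M∘n′)
(inl κ) (inl α)` — D1's composite tensor on the unpacked border rows AT the multiplier block, doubly periodised in (insertion bond, fluctuation site); the
covariance of the unpacked tensor is `HComp_translate` over (`qSym_translate`, `rowsK_translate tabs.hVt`). -/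
theorem perZ_dper_VComp_inl_inr' (hm : m ≠ 1) (hM : ∀ i, M i = Lc ^ m * M' i) (κ : Fin (d + 1)) (u x z : Site (d + 1)) (α ρ : Fin (d + 1)) :
    perZ M (dper M (VComp Lc (qSym Lc) lamPerfect tabs.V m κ u)) x z (Sum.inl α) (Sum.inr ρ) =
      if off (Lc ^ m) z = 0 then
        ∑' n' : Site (d + 1), ∑' n : Site (d + 1),
          HComp Lc (qSym Lc) lamPerfect (rowsK Lc tabs.V) m ρ (blk (Lc ^ m) z) (translate M u n) (translate M x n') (Sum.inl κ) (Sum.inl α)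
      else 0 := by
  rw [VComp_of_ne_one Lc (qSym Lc) lamPerfect tabs.V hm]
  exact perZ_dper_packK_inl_inr' (BalabanStepJetsSucc.one_le_pow_Lc (Lc := Lc) m) hM
    (fun ρ w t => HComp_translate Lc (qSym Lc) lamPerfect (rowsK Lc tabs.V) (qSym_translate Lc) (rowsK_translate tabs.hVt) m ρ w t) κ u x z α ρ

end Packed

end Summit.QuantumFields.BalabanUV.Beta.FP.PeriodisedBorderTablesRecord

end
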